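import Summits.QuantumFields.YangMills.Theorems.BalabanLadderIRcofEquipartitionSeamSliceKernelSecW
import HarnessLib

/-!
# Crux `IRcof` (stmt-QuantumFields-26930) · line `equipartition_seam` (row 47) · located stub L `SpectralDict.SliceRealisationV` — helper:
# the gauge-averaged SLICE KERNEL of a GENERAL weight, F7 ∕ 7 — §13 SEAM TRANSPORT: the electric seam may sit on ANY temporal layer (`integral_seamAt_eq_integral_seamAt`, `secW_withEl_eq_integral_layers_seamAt`; abstract half of (W), step (a))

SOURCE OF RECORD: `Cruxes/IRcof/Lines/equipartition_seam_SliceKernel.lean` rev 9 (crux write 148dcb46cebb, 2172 l.; author ideator ym-ir-idea-22 g7; critic ym-ir-crit-3 g5 TYPEREADs CLEAN of revs 1–6 (bus l.1748 ∕ 1758 ∕ 1768 ∕ 1775 ∕ 1780), placement ruling H1 ∕ H2 (l.1748: §1 → Literature = lit-4 L34 p694639; §2 onward → ≤ 400-line Theorems files) — split VERBATIM along its §§ by LEAD prover ym-ir-line-ab-p1 g8 on the ideator's LAND-ASK H2 (bus l.1786 ∕ l.1789: files F1–F7, each importing the previous).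

HONEST FRAMING.  Elementary measure theory ∕ Fubini on compact groups (Lüscher 1977 ∕ Osterwalder–Seiler 1978 transfer-matrix positivity, weight-generic); proves NO located stub of row 47 by itself (S1, S3ʷ, T, L, N, S5ᵛ open); row 47 class PWP, mechanism 0, width 0; `IRcof` ∕ `IR` 0∕1; the Yang–Mills mass gap (Clay) is NOT proved by anything in this tree; R4 closes only the conditional finite-𝕋⁴ rung `BalabanLadder.UV`.
-/

noncomputable section

open MeasureTheory ProbabilityTheory Finset Filter Function
open scoped BigOperators

namespace Summit.QuantumFields.YangMills.Cruxes.IRcof.EquipartitionSeam.SliceKernel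

open Literature.Analysis.Matrix (IsPosDefKernel isPosDefKernel_const IsPosDefKernel.integral_prod_nonneg_of_measurable)
open Literature.MathematicalPhysics.QuantumFieldTheory (haarProbability integral_integral_fibreAverage_nonneg
  integrable_of_abs_le_one abs_mul_mul_le_one abs_integral_le_one)
open Literature.MathematicalPhysics.QuantumFieldTheory
open Summit.QuantumFields.YangMills.Cruxes.IRcof.EquipartitionSeam.KernelCurrency (sectorTensor withEl secZ secW)
open Literature.MathematicalPhysics.QuantumLattice (torusLift torusEdge)


/-! ## §13 SEAM TRANSPORT: the electric seam may sit on ANY temporal layer (abstract half of (W), step (a)) -/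

section SeamTransport

variable {P Λ H : Type*} [Fintype P] [Fintype Λ] [Group H] [TopologicalSpace H] [IsTopologicalGroup H]
  [CompactSpace H] [MeasurableSpace H] [BorelSpace H] (src tgt : Λ → P) (w : H → ℝ)

omit [Fintype P] [Fintype Λ] [TopologicalSpace H] [IsTopologicalGroup H] [CompactSpace H] [MeasurableSpace H]
  [BorelSpace H] in
/-- Auxiliary `ctwist_one_apply` of the slice-kernel port (its statement is its type; rôle explained in the module ∕ section docstrings). -/
theorem ctwist_one_apply (V : Λ → H) : ctwist (1 : Λ → H) V = V := by
  rw [ctwist_one]; rfl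

/-- A seam field `z` placed on temporal layer `t₀` only (`1` on every other layer). -/
def seamAt {m : ℕ} (t₀ : Fin m) (z : Λ → H) : Fin m → Λ → H := fun t => if t = t₀ then z else 1

/-- The slice substitution carrying a seam across slice `s`: twist slice `s` by `z⁻¹`, leave the other slices. -/
def sliceSub {m : ℕ} (s : Fin m) (z : Λ → H) (V : Fin m → Λ → H) : Fin m → Λ → H :=
  fun t => if t = s then ctwist z⁻¹ (V t) else V t

omit [Fintype P] [Fintype Λ] [TopologicalSpace H] [IsTopologicalGroup H] [CompactSpace H] [MeasurableSpace H]
  [BorelSpace H] in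
/-- Auxiliary `seamAt_self` of the slice-kernel port (its statement is its type; rôle explained in the module ∕ section docstrings). -/
theorem seamAt_self {m : ℕ} (t₀ : Fin m) (z : Λ → H) : seamAt t₀ z t₀ = z := by simp [seamAt]

omit [Fintype P] [Fintype Λ] [TopologicalSpace H] [IsTopologicalGroup H] [CompactSpace H] [MeasurableSpace H]
  [BorelSpace H] in
/-- Auxiliary `seamAt_of_ne` of the slice-kernel port (its statement is its type; rôle explained in the module ∕ section docstrings). -/
theorem seamAt_of_ne {m : ℕ} {t₀ t : Fin m} (z : Λ → H) (h : t ≠ t₀) : seamAt t₀ z t = 1 := by simp [seamAt, h]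

omit [Fintype P] [Fintype Λ] [TopologicalSpace H] [IsTopologicalGroup H] [CompactSpace H] [MeasurableSpace H]
  [BorelSpace H] in
/-- The slice substitution as a layer-wise central twist (the shape `pullback_assembleZero_sliceTwist` consumes). -/
theorem sliceSub_eq_ctwist {m : ℕ} (s : Fin m) (z : Λ → H) (V : Fin m → Λ → H) :
    sliceSub s z V = fun t => ctwist (seamAt s z⁻¹ t) (V t) := by
  funext t
  unfold sliceSub seamAt
  split_ifs
  · rfl
  · exact (congrFun ctwist_one (V t)).symm

omit [Fintype P] in
/-- Auxiliary `measurePreserving_sliceSub` of the slice-kernel port (its statement is its type; rôle explained in the module ∕ section docstrings). -/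
theorem measurePreserving_sliceSub {m : ℕ} (s : Fin m) (z : Λ → H) :
    MeasurePreserving (sliceSub s z)
      (Measure.pi fun _ : Fin m => Measure.pi fun _ : Λ => haarProbability H)
      (Measure.pi fun _ : Fin m => Measure.pi fun _ : Λ => haarProbability H) := by
  unfold sliceSub
  exact measurePreserving_pi (f := fun (t : Fin m) (V : Λ → H) => if t = s then ctwist z⁻¹ V else V)
    (fun _ : Fin m => Measure.pi fun _ : Λ => haarProbability H)
    (fun _ : Fin m => Measure.pi fun _ : Λ => haarProbability H) fun t => by
      by_cases h : t = s
      · simp only [h, if_true]; exact measurePreserving_ctwist z⁻¹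
      · simp only [h, if_false]; exact MeasurePreserving.id _

omit [Fintype P] [CompactSpace H] in
/-- Auxiliary `measurable_sliceSub` of the slice-kernel port (its statement is its type; rôle explained in the module ∕ section docstrings). -/
theorem measurable_sliceSub [SecondCountableTopology H] {m : ℕ} (s : Fin m)
    (z : Λ → H) : Measurable (sliceSub s z : (Fin m → Λ → H) → Fin m → Λ → H) := by
  refine measurable_pi_lambda _ fun t => ?_
  unfold sliceSub
  by_cases h : t = s
  · simp only [h, if_true]; exact (continuous_ctwist z⁻¹).measurable.comp (measurable_pi_apply s)
  · simp only [h, if_false]; exact measurable_pi_apply t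

omit [Fintype P] [TopologicalSpace H] [IsTopologicalGroup H] [CompactSpace H] [MeasurableSpace H] [BorelSpace H] in
/-- Moving a twist by a central `z⁻¹` from the earlier slice onto the later slice of one temporal layer. -/
theorem tempKernel_ctwist_inv_left {z : Λ → H} (hz : ∀ l, z l ∈ Subgroup.center H) (A : Λ → H) (g : P → H)
    (B : Λ → H) : tempKernel src tgt w (ctwist z⁻¹ A) g B = tempKernel src tgt w A g (ctwist z B) := by
  have h2 : ctwist z⁻¹ (ctwist z B) = B := by simpa only [inv_inv] using ctwist_ctwist_inv z⁻¹ B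
  conv_lhs => rw [← h2]
  exact tempKernel_ctwist src tgt w (center_inv hz) A g (ctwist z B)

omit [Fintype P] [TopologicalSpace H] [IsTopologicalGroup H] [CompactSpace H] [MeasurableSpace H] [BorelSpace H] in
/-- **One layer under the seam-carrying substitution:** substituting slice `finRotate m t₀` (the later slice of layer
`t₀`) by its `z⁻¹`-twist turns the layered temporal weight with the seam `z` on layer `t₀` into the one with the seam on
layer `finRotate m t₀`, layer by layer. -/
theorem tempKernel_sliceSub_seamAt {m : ℕ} {z : Λ → H} (hz : ∀ l, z l ∈ Subgroup.center H) (t₀ t : Fin m)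
    (V : Fin m → Λ → H) (g : P → H) :
    tempKernel src tgt w (sliceSub (finRotate m t₀) z V t) g
        (ctwist (seamAt t₀ z t) (sliceSub (finRotate m t₀) z V (finRotate m t))) =
      tempKernel src tgt w (V t) g (ctwist (seamAt (finRotate m t₀) z t) (V (finRotate m t))) := by
  by_cases ht : t = t₀
  · subst ht
    rw [seamAt_self]
    have h1 : sliceSub (finRotate m t) z V (finRotate m t) = ctwist z⁻¹ (V (finRotate m t)) := by
      simp [sliceSub]
    rw [h1, ctwist_ctwist_inv]
    by_cases h0 : t = finRotate m t
    · have h2 : sliceSub (finRotate m t) z V t = ctwist z⁻¹ (V t) := by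
        unfold sliceSub; rw [if_pos h0]
      have h3 : seamAt (finRotate m t) z t = z := by unfold seamAt; rw [if_pos h0]
      rw [h2, h3]
      exact tempKernel_ctwist_inv_left src tgt w hz _ _ _
    · have h2 : sliceSub (finRotate m t) z V t = V t := by unfold sliceSub; rw [if_neg h0]
      rw [h2, seamAt_of_ne z h0, ctwist_one_apply]
  · have hne : finRotate m t ≠ finRotate m t₀ := fun h => ht ((finRotate m).injective h)
    have h1 : sliceSub (finRotate m t₀) z V (finRotate m t) = V (finRotate m t) := by
      unfold sliceSub; rw [if_neg hne]
    rw [h1, seamAt_of_ne z ht, ctwist_one_apply]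
    by_cases h0 : t = finRotate m t₀
    · have h2 : sliceSub (finRotate m t₀) z V t = ctwist z⁻¹ (V t) := by unfold sliceSub; rw [if_pos h0]
      have h3 : seamAt (finRotate m t₀) z t = z := by unfold seamAt; rw [if_pos h0]
      rw [h2, h3]
      exact tempKernel_ctwist_inv_left src tgt w hz _ _ _
    · have h2 : sliceSub (finRotate m t₀) z V t = V t := by unfold sliceSub; rw [if_neg h0]
      rw [h2, seamAt_of_ne z h0, ctwist_one_apply]

omit [Fintype P] [TopologicalSpace H] [IsTopologicalGroup H] [CompactSpace H] [MeasurableSpace H] [BorelSpace H] in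
/-- The layered integrand under the seam-carrying substitution (pointwise form of the transport). -/
theorem integrand_sliceSub_seamAt {m : ℕ} (Mg : (Λ → H) → ℝ) (F : (Fin m → Λ → H) × (Fin m → P → H) → ℝ)
    {z : Λ → H} (hz : ∀ l, z l ∈ Subgroup.center H) (hMz : ∀ V, Mg (ctwist z⁻¹ V) = Mg V) (t₀ : Fin m)
    (hFz : ∀ (V : Fin m → Λ → H) (E : Fin m → P → H), F (sliceSub (finRotate m t₀) z V, E) = F (V, E))
    (V : Fin m → Λ → H) (E : Fin m → P → H) :
    F (sliceSub (finRotate m t₀) z V, E) * ((∏ t, Mg (sliceSub (finRotate m t₀) z V t)) *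
        ∏ t, tempKernel src tgt w (sliceSub (finRotate m t₀) z V t) (E t)
          (ctwist (seamAt t₀ z t) (sliceSub (finRotate m t₀) z V (finRotate m t)))) =
      F (V, E) * ((∏ t, Mg (V t)) *
        ∏ t, tempKernel src tgt w (V t) (E t) (ctwist (seamAt (finRotate m t₀) z t) (V (finRotate m t)))) := by
  rw [hFz V E]
  congr 2
  · refine Finset.prod_congr rfl fun t _ => ?_
    unfold sliceSub
    split_ifs
    · exact hMz _
    · rfl
  · exact Finset.prod_congr rfl fun t _ => tempKernel_sliceSub_seamAt src tgt w hz t₀ t V (E t)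

/-- **SEAM TRANSPORT, one layer.**  In the layered slice integral (species factor `F`, slice weights `Mg`, temporal
kernel words) the seam `z` may be moved from layer `t₀` to the next layer `finRotate m t₀`, provided `F` is blind to the
`z⁻¹`-twist of slice `finRotate m t₀` and `Mg` is `z⁻¹`-twist invariant: the substitution `sliceSub` preserves the
product Haar measure. -/
theorem integral_seamAt_eq_integral_seamAt_finRotate [SecondCountableTopology H] {m : ℕ} (hw : Continuous w)
    {Mg : (Λ → H) → ℝ} (hMm : Measurable Mg) {F : (Fin m → Λ → H) × (Fin m → P → H) → ℝ} (hFm : Measurable F)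
    {z : Λ → H} (hz : ∀ l, z l ∈ Subgroup.center H) (hMz : ∀ V, Mg (ctwist z⁻¹ V) = Mg V) (t₀ : Fin m)
    (hFz : ∀ (V : Fin m → Λ → H) (E : Fin m → P → H), F (sliceSub (finRotate m t₀) z V, E) = F (V, E)) :
    ∫ q : (Fin m → Λ → H) × (Fin m → P → H),
        F q * ((∏ t, Mg (q.1 t)) *
          ∏ t, tempKernel src tgt w (q.1 t) (q.2 t) (ctwist (seamAt t₀ z t) (q.1 (finRotate m t))))
      ∂((Measure.pi fun _ => Measure.pi fun _ : Λ => haarProbability H).prod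
          (Measure.pi fun _ => Measure.pi fun _ : P => haarProbability H)) =
    ∫ q : (Fin m → Λ → H) × (Fin m → P → H),
        F q * ((∏ t, Mg (q.1 t)) *
          ∏ t, tempKernel src tgt w (q.1 t) (q.2 t)
            (ctwist (seamAt (finRotate m t₀) z t) (q.1 (finRotate m t))))
      ∂((Measure.pi fun _ => Measure.pi fun _ : Λ => haarProbability H).prod
          (Measure.pi fun _ => Measure.pi fun _ : P => haarProbability H)) := by
  set ν : Measure ((Fin m → Λ → H) × (Fin m → P → H)) :=
    (Measure.pi fun _ => Measure.pi fun _ : Λ => haarProbability H).prod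
      (Measure.pi fun _ => Measure.pi fun _ : P => haarProbability H) with hν
  have hψ : MeasurePreserving (Prod.map (sliceSub (finRotate m t₀) z) id) ν ν :=
    (measurePreserving_sliceSub (finRotate m t₀) z).prod (MeasurePreserving.id _)
  -- measurability of the integrand with the seam on layer `t₀`
  have hq1 : ∀ t : Fin m, Measurable fun q : (Fin m → Λ → H) × (Fin m → P → H) => q.1 t :=
    fun t => (measurable_pi_apply t).comp measurable_fst
  have hq2 : ∀ t : Fin m, Measurable fun q : (Fin m → Λ → H) × (Fin m → P → H) => q.2 t :=
    fun t => (measurable_pi_apply t).comp measurable_snd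
  have hΦ : Measurable fun q : (Fin m → Λ → H) × (Fin m → P → H) =>
      F q * ((∏ t, Mg (q.1 t)) *
        ∏ t, tempKernel src tgt w (q.1 t) (q.2 t) (ctwist (seamAt t₀ z t) (q.1 (finRotate m t)))) := by
    refine hFm.mul ((Finset.measurable_prod _ fun t _ => hMm.comp (hq1 t)).mul
      (Finset.measurable_prod _ fun t _ => ?_))
    exact (continuous_tempKernel src tgt w hw).measurable.comp
      ((hq1 t).prodMk ((hq2 t).prodMk ((continuous_ctwist _).measurable.comp (hq1 _))))
  calc ∫ q, F q * ((∏ t, Mg (q.1 t)) *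
          ∏ t, tempKernel src tgt w (q.1 t) (q.2 t) (ctwist (seamAt t₀ z t) (q.1 (finRotate m t)))) ∂ν
      = ∫ q, F q * ((∏ t, Mg (q.1 t)) *
          ∏ t, tempKernel src tgt w (q.1 t) (q.2 t) (ctwist (seamAt t₀ z t) (q.1 (finRotate m t))))
          ∂(Measure.map (Prod.map (sliceSub (finRotate m t₀) z) id) ν) := by rw [hψ.map_eq]
    _ = ∫ q, (fun q : (Fin m → Λ → H) × (Fin m → P → H) => F q * ((∏ t, Mg (q.1 t)) *
          ∏ t, tempKernel src tgt w (q.1 t) (q.2 t) (ctwist (seamAt t₀ z t) (q.1 (finRotate m t)))))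
          (Prod.map (sliceSub (finRotate m t₀) z) id q) ∂ν :=
        integral_map_of_stronglyMeasurable hψ.measurable hΦ.stronglyMeasurable
    _ = _ := by
        refine integral_congr_ae (Eventually.of_forall fun q => ?_)
        obtain ⟨V, E⟩ := q
        simp only [Prod.map_apply, id_eq]
        exact integrand_sliceSub_seamAt src tgt w Mg F hz hMz t₀ hFz V E


/-- **SEAM TRANSPORT, `k` layers** (iterate of the one-layer step; `F` blind to the `z⁻¹`-twist of EVERY slice). -/
theorem integral_seamAt_eq_integral_seamAt_iterate [SecondCountableTopology H] {m : ℕ} (hw : Continuous w)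
    {Mg : (Λ → H) → ℝ} (hMm : Measurable Mg) {F : (Fin m → Λ → H) × (Fin m → P → H) → ℝ} (hFm : Measurable F)
    {z : Λ → H} (hz : ∀ l, z l ∈ Subgroup.center H) (hMz : ∀ V, Mg (ctwist z⁻¹ V) = Mg V)
    (hFz : ∀ (s : Fin m) (V : Fin m → Λ → H) (E : Fin m → P → H), F (sliceSub s z V, E) = F (V, E))
    (t₀ : Fin m) (k : ℕ) :
    ∫ q : (Fin m → Λ → H) × (Fin m → P → H),
        F q * ((∏ t, Mg (q.1 t)) *
          ∏ t, tempKernel src tgt w (q.1 t) (q.2 t) (ctwist (seamAt t₀ z t) (q.1 (finRotate m t))))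
      ∂((Measure.pi fun _ => Measure.pi fun _ : Λ => haarProbability H).prod
          (Measure.pi fun _ => Measure.pi fun _ : P => haarProbability H)) =
    ∫ q : (Fin m → Λ → H) × (Fin m → P → H),
        F q * ((∏ t, Mg (q.1 t)) *
          ∏ t, tempKernel src tgt w (q.1 t) (q.2 t)
            (ctwist (seamAt ((finRotate m)^[k] t₀) z t) (q.1 (finRotate m t))))
      ∂((Measure.pi fun _ => Measure.pi fun _ : Λ => haarProbability H).prod
          (Measure.pi fun _ => Measure.pi fun _ : P => haarProbability H)) := by
  induction k with
  | zero => rfl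
  | succ k ih =>
    rw [ih, Function.iterate_succ_apply']
    exact integral_seamAt_eq_integral_seamAt_finRotate src tgt w hw hMm hFm hz hMz _ (hFz _)

/-- **SEAM TRANSPORT: the seam may sit on ANY layer.**  For a species factor blind to central slice twists and a
twist-invariant slice weight, the layered slice integral does not depend on which temporal layer carries the seam `z`. -/
theorem integral_seamAt_eq_integral_seamAt [SecondCountableTopology H] {m : ℕ} (hw : Continuous w)
    {Mg : (Λ → H) → ℝ} (hMm : Measurable Mg) {F : (Fin m → Λ → H) × (Fin m → P → H) → ℝ} (hFm : Measurable F)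
    {z : Λ → H} (hz : ∀ l, z l ∈ Subgroup.center H) (hMz : ∀ V, Mg (ctwist z⁻¹ V) = Mg V)
    (hFz : ∀ (s : Fin m) (V : Fin m → Λ → H) (E : Fin m → P → H), F (sliceSub s z V, E) = F (V, E))
    (t₀ t₁ : Fin m) :
    ∫ q : (Fin m → Λ → H) × (Fin m → P → H),
        F q * ((∏ t, Mg (q.1 t)) *
          ∏ t, tempKernel src tgt w (q.1 t) (q.2 t) (ctwist (seamAt t₀ z t) (q.1 (finRotate m t))))
      ∂((Measure.pi fun _ => Measure.pi fun _ : Λ => haarProbability H).prod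
          (Measure.pi fun _ => Measure.pi fun _ : P => haarProbability H)) =
    ∫ q : (Fin m → Λ → H) × (Fin m → P → H),
        F q * ((∏ t, Mg (q.1 t)) *
          ∏ t, tempKernel src tgt w (q.1 t) (q.2 t) (ctwist (seamAt t₁ z t) (q.1 (finRotate m t))))
      ∂((Measure.pi fun _ => Measure.pi fun _ : Λ => haarProbability H).prod
          (Measure.pi fun _ => Measure.pi fun _ : P => haarProbability H)) := by
  obtain ⟨n, rfl⟩ : ∃ n, m = n + 1 := ⟨m - 1, by have := t₀.pos; omega⟩
  -- walk the seam from layer `0` to any layer, one `finRotate` step at a time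
  have key : ∀ t₂ : Fin (n + 1),
      ∫ q : (Fin (n + 1) → Λ → H) × (Fin (n + 1) → P → H),
          F q * ((∏ t, Mg (q.1 t)) *
            ∏ t, tempKernel src tgt w (q.1 t) (q.2 t) (ctwist (seamAt 0 z t) (q.1 (finRotate (n + 1) t))))
        ∂((Measure.pi fun _ => Measure.pi fun _ : Λ => haarProbability H).prod
            (Measure.pi fun _ => Measure.pi fun _ : P => haarProbability H)) =
      ∫ q : (Fin (n + 1) → Λ → H) × (Fin (n + 1) → P → H),
          F q * ((∏ t, Mg (q.1 t)) *
            ∏ t, tempKernel src tgt w (q.1 t) (q.2 t) (ctwist (seamAt t₂ z t) (q.1 (finRotate (n + 1) t))))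
        ∂((Measure.pi fun _ => Measure.pi fun _ : Λ => haarProbability H).prod
            (Measure.pi fun _ => Measure.pi fun _ : P => haarProbability H)) := by
    intro t₂
    induction t₂ using Fin.induction with
    | zero => rfl
    | succ i ih =>
      have hsucc : i.succ = finRotate (n + 1) (Fin.castSucc i) := by
        rw [finRotate_apply, Fin.coeSucc_eq_succ]
      rw [ih, hsucc]
      exact integral_seamAt_eq_integral_seamAt_finRotate src tgt w hw hMm hFm hz hMz _ (hFz _)
  exact (key t₀).symm.trans (key t₁)

end SeamTransport

section SeamTransportElectric

variable {G H : Type} [Group G] [Group H] (π : H →* G)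

/-- Auxiliary `elTwist_mem_ker` of the slice-kernel port (its statement is its type; rôle explained in the module ∕ section docstrings). -/
theorem elTwist_mem_ker {b₁ b₂ b₃ : ℕ} (e : Fin 3 → ↥π.ker) (l : FinSpatialSite b₁ b₂ b₃ × Fin 3) :
    elTwist π e l ∈ π.ker := by
  unfold elTwist
  split_ifs
  · exact (e l.2).2
  · exact one_mem _

/-- §12's seam family is `seamAt 0 (elTwist π e)`. -/
theorem seamField_eq_seamAt {n b₁ b₂ b₃ : ℕ} (e : Fin 3 → ↥π.ker) :
    (seamField π e : Fin (n + 1) → FinSpatialSite b₁ b₂ b₃ × Fin 3 → H) = seamAt 0 (elTwist π e) := by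
  funext t l
  by_cases h : t = 0
  · subst h; simp [seamField, seamAt]
  · have h' : (t : ℕ) ≠ 0 := fun h0 => h (Fin.ext (by rw [Fin.val_zero]; exact h0))
    simp [seamField, seamAt, h, h']

variable [TopologicalSpace G] [MeasurableSpace G] [BorelSpace G] [TopologicalSpace H]
  [IsTopologicalGroup H] [CompactSpace H] [MeasurableSpace H] [BorelSpace H] [SecondCountableTopology H]

set_option maxHeartbeats 1600000 in
/-- **`W_{w,A}(withEl z₀ e)` with the electric seam on ANY temporal layer `t₁`** — §12's layered form composed with the seam
transport of §13 (the pulled-back species is blind to `ker π`-valued slice twists, `pullback_assembleZero_sliceTwist`; the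
magnetic weight is seam-invariant, `magW_ctwist_elTwist`).  Step (a) of the abstract half of (W): the seam can be parked on the
layer just after the time window of `A`. -/
theorem secW_withEl_eq_integral_layers_seamAt (w : H → ℝ) (hw : Continuous w) (hcl : ∀ g h : H, w (g * h * g⁻¹) = w h)
    (hker : π.ker ≤ Subgroup.center H) (hπ : Continuous π) (z₀ : Sector π) (e : Fin 3 → ↥π.ker) (S : ℕ)
    (A : YMSpecies G) (t₁ : Fin (2 * S + 1)) :
    secW π w (withEl π z₀ e) S A =
      ∫ q : (Fin (2 * S + 1) → (FinSpatialSite (2 * S + 1) (2 * S + 1) (2 * S + 1) × Fin 3 → H)) ×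
          (Fin (2 * S + 1) → (FinSpatialSite (2 * S + 1) (2 * S + 1) (2 * S + 1) → H)),
        A.F (fun d => π (torusLift (2 * S + 1) ((finTorusConfigEquivSite H (2 * S + 1)).symm (assembleZero q)) d)) *
          ((∏ t, magW π w z₀ (q.1 t)) *
            ∏ t, tempKernel Prod.fst
              (fun l : FinSpatialSite (2 * S + 1) (2 * S + 1) (2 * S + 1) × Fin 3 => l.1.shift l.2) w
              (q.1 t) (q.2 t) (ctwist (seamAt t₁ (elTwist π e) t) (q.1 (finRotate (2 * S + 1) t))))
      ∂((Measure.pi fun _ => Measure.pi fun _ : FinSpatialSite (2 * S + 1) (2 * S + 1) (2 * S + 1) × Fin 3 =>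
            haarProbability H).prod
          (Measure.pi fun _ => Measure.pi fun _ : FinSpatialSite (2 * S + 1) (2 * S + 1) (2 * S + 1) =>
            haarProbability H)) := by
  rw [secW_withEl_eq_integral_layers π w hw hcl hker hπ z₀ e S A, seamField_eq_seamAt π e]
  have hFm : Measurable fun q : (Fin (2 * S + 1) → (FinSpatialSite (2 * S + 1) (2 * S + 1) (2 * S + 1) × Fin 3 → H)) ×
      (Fin (2 * S + 1) → (FinSpatialSite (2 * S + 1) (2 * S + 1) (2 * S + 1) → H)) =>
      A.F (fun d => π (torusLift (2 * S + 1) ((finTorusConfigEquivSite H (2 * S + 1)).symm (assembleZero q)) d)) := by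
    refine A.measurable.comp (measurable_pi_lambda _ fun d => hπ.measurable.comp ?_)
    exact (measurable_pi_apply _).comp ((finTorusConfigEquivSite H (2 * S + 1)).symm.measurable.comp
      measurable_assembleZero)
  have hMz : ∀ V : FinSpatialSite (2 * S + 1) (2 * S + 1) (2 * S + 1) × Fin 3 → H,
      magW π w z₀ (ctwist (elTwist π e)⁻¹ V) = magW π w z₀ V := fun V => by
    rw [← elTwist_inv, magW_ctwist_elTwist π w hker z₀ e⁻¹ V]
  have hFz : ∀ (s : Fin (2 * S + 1))
      (V : Fin (2 * S + 1) → (FinSpatialSite (2 * S + 1) (2 * S + 1) (2 * S + 1) × Fin 3 → H))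
      (E : Fin (2 * S + 1) → (FinSpatialSite (2 * S + 1) (2 * S + 1) (2 * S + 1) → H)),
      A.F (fun d => π (torusLift (2 * S + 1) ((finTorusConfigEquivSite H (2 * S + 1)).symm
          (assembleZero (sliceSub s (elTwist π e) V, E))) d)) =
        A.F (fun d => π (torusLift (2 * S + 1) ((finTorusConfigEquivSite H (2 * S + 1)).symm
          (assembleZero (V, E))) d)) := by
    intro s V E
    rw [sliceSub_eq_ctwist]
    refine pullback_assembleZero_sliceTwist π A (fun t => seamAt s (elTwist π e)⁻¹ t) (fun t l => ?_) (V, E)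
    unfold seamAt
    split_ifs
    · rw [Pi.inv_apply]; exact inv_mem (elTwist_mem_ker π e l)
    · exact one_mem _
  exact integral_seamAt_eq_integral_seamAt Prod.fst (fun l => l.1.shift l.2) w hw
    (continuous_magW π w hw z₀).measurable hFm (elTwist_mem_center π hker e) hMz hFz 0 t₁

end SeamTransportElectric

end Summit.QuantumFields.YangMills.Cruxes.IRcof.EquipartitionSeam.SliceKernel

end
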